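import Literature.AlgebraicGeometry.Motives.CartierDivisorIdealSheaf
import Literature.AlgebraicGeometry.Motives.CartierDivisorOfComplement
import Literature.AlgebraicGeometry.Motives.CurvePointDivisor
import Literature.AlgebraicGeometry.Motives.CartierDivisorCurveDegree
import Mathlib.RingTheory.Ideal.Quotient.Nilpotent
import HarnessLib

/-!
# A reduced effective Cartier divisor has multiplicity `≤ 1` at every point with discrete valuation ring

Görtz–Wedhorn I, Remark 11.27 / (11.12): an effective Cartier divisor `D = (U_i, f_i)` on `X` "is" the closed subscheme `Z(D)`,
`Z(D) ∩ U_i = V(f_i)`, of ideal `𝒪_X(−D)`; Hartshorne II.6 (p. 130, Prop. 6.11): at a point `x` whose local ring is a discrete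
valuation ring the local equation has a vanishing order `ord_x(D) = v_x(f_i) ≥ 0`, the coefficient of the prime divisor `cl{x}` in
the Weil divisor of `D`.  Then:

  **if the scheme `Z(D)` is reduced, `ord_x(D) ≤ 1` at every such `x`** (and `= 1` exactly on `Supp D`):

`Z(D)` reduced ⇒ the ideals `𝒪_X(−D)(W) = (t) ⊆ Γ(W, 𝒪_X)` are radical (`Γ(W)/(t) = Γ(Z(D) ∩ W, 𝒪)` is reduced) ⇒ `(t)·𝒪_{X,x}` is radical
(localisation) ⇒ for a uniformizer `π` and `n = v_x(t)`: `πⁿ ∈ (t)` forces `π ∈ (t)`, i.e. `n ≤ 1`.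

In the tree՚s currency (`Motives/CartierDivisor*`: `hD.idealSheaf = 𝒪_X(−D)` as a Mathlib `IdealSheafData` with closed subscheme
`hD.idealSheaf.subscheme`; `CartierDivisor.ordAt` = Mathlib `Scheme.ord` of a local equation; `ComplementDivisor.RadicalAt`) we prove,
theorems only (no definition, no named fact, no `sorry`):

* `isRadical_ideal_of_isReduced_subscheme` — for ANY quasi-coherent ideal `I` with `Z(I)` reduced, every `I(U)` (`U` affine) is radical;
* `isRadical_map_germ` — radical ideals of `Γ(W, 𝒪_X)` stay radical in the local rings `𝒪_{X,x}`, `x ∈ W` (Mathlib `IsLocalization.map_radical`);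
* `CartierDivisor.IsEffective.radicalAt_of_isReduced` — `Z(D)` reduced ⇒ each local equation `f_i` is radical at each `x ∈ U_i`;
* `CartierDivisor.IsEffective.ordAt_le_one_of_radicalAt`, **`…ordAt_le_one_of_isReduced`**, `…ordAt_eq_one_of_isReduced` (on `Supp D`)
  — at points `x` with `𝒪_{X,x}` a discrete valuation ring;
* the curve heads **`CurvePlaces.ordAt_le_one_of_isReduced_subscheme`**, `CurvePlaces.ordAt_eq_one_of_isReduced_subscheme` — smooth
  curves over a field, every closed point (`★ isDiscreteValuationRing_stalk`);
* `CartierDivisor.IsEffective.mem_range_subschemeι_iff` — the points of `Z(D)` are `Supp D` (`¬ D.Avoids x`).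

Use (cell `hodgecm-mathlib`, D-0151; crux HLiu418 = stmt-HodgeConjecture-24832): leaf (P3-ii) of the «fibre dictionary» of Step I of
[Lange2023 Lem. 4.4.4] = [Milne1986 Lem. 6.7] on road (E): the fibres of the étale `ψ : C × W̃ → J` over `a ∈ V(K)` are reduced, they are
`Z(ι_a^*Θ)` (★ `CartierDivisor.IsEffective.isPullback_subscheme_pullbackAvoiding`), hence `ord_P(ι_a^*Θ) = 1` on the support —
MULTIPLICITY ONE.  COUNT-NEUTRAL.  HC_CM is proved only modulo the 7 printed citations until rung 0 closes.

Mathlib searched (pin): `Ideal.isRadical_iff_quotient_reduced`, `RingHom.kerLift_injective`, `isReduced_of_injective`,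
`IsReduced.component_reduced`, `Scheme.IdealSheafData.ker_subschemeι_app`, `range_subschemeι`, `IsAffineOpen.isLocalization_stalk`,
`IsLocalization.map_radical`, `Ideal.radical_eq_iff`, `Ideal.map_span`, `IsDiscreteValuationRing.exists_irreducible`,
`IsDiscreteValuationRing.addVal_uniformizer`, `Scheme.ord_mul` (all used).

## References
* [GortzWedhorn2020] U. Görtz, T. Wedhorn, *Algebraic Geometry I*, 2nd ed. (2020), Remark 11.27 and (11.12) (pp. 305–306),
  (11.13) «the vanishing order of `D`» with Lemma 11.37.
* [Hartshorne1977] R. Hartshorne, *Algebraic Geometry* (1977), II.6 p. 130 (the valuation `v_Y`), Prop. 6.11 and Remark 6.11.2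
  (pp. 141–142), II Example 3.2.6 / Ex. 2.3 (reduced schemes).
-/

noncomputable section

open CategoryTheory AlgebraicGeometry TopologicalSpace Opposite Ideal

universe u

namespace Literature.AlgebraicGeometry.Motives

/-! ## §1 Reduced closed subschemes have radical ideals -/

/-- **If the closed subscheme `Z(I)` of a quasi-coherent ideal `I ⊆ 𝒪_X` is reduced, then `I(U)` is a radical ideal of `Γ(U, 𝒪_X)`
for every affine open `U`**: `Γ(U, 𝒪_X)/I(U) ↪ Γ(Z(I) ∩ U, 𝒪_{Z(I)})` (Mathlib `ker_subschemeι_app`), and the target is reduced.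
[cite: Hartshorne1977, II Example 3.2.6 (reduced induced structure) and Ex. 2.3] -/
theorem isRadical_ideal_of_isReduced_subscheme {X : Scheme.{u}} (I : X.IdealSheafData) [IsReduced I.subscheme]
    (U : X.affineOpens) : (I.ideal U).IsRadical := by
  rw [← I.ker_subschemeι_app U, Ideal.isRadical_iff_quotient_reduced]
  exact isReduced_of_injective (RingHom.kerLift (I.subschemeι.app U).hom) (RingHom.kerLift_injective _)

/-- **Radical ideals stay radical in the local rings**: for an affine open `W ∋ x` and a radical ideal `J ⊆ Γ(W, 𝒪_X)`, the ideal
`J · 𝒪_{X,x}` is radical (`𝒪_{X,x}` is a localisation of `Γ(W, 𝒪_X)`, Mathlib `IsAffineOpen.isLocalization_stalk`, and localisation commutes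
with radicals, `IsLocalization.map_radical`). [cite: GortzWedhorn2020, Remark 11.27 and (11.12) (pp. 305–306)] -/
theorem isRadical_map_germ {X : Scheme.{u}} {W : X.Opens} (hW : IsAffineOpen W) {x : X} (hx : x ∈ W) {J : Ideal Γ(X, W)}
    (hJ : J.IsRadical) : (J.map (X.presheaf.germ W x hx).hom).IsRadical := by
  letI : Algebra Γ(X, W) (X.presheaf.stalk x) := (X.presheaf.germ W x hx).hom.toAlgebra
  haveI : IsLocalization.AtPrime (X.presheaf.stalk x) (hW.primeIdealOf ⟨x, hx⟩).asIdeal :=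
    hW.isLocalization_stalk ⟨x, hx⟩
  have e : (X.presheaf.germ W x hx).hom = algebraMap Γ(X, W) (X.presheaf.stalk x) := rfl
  rw [e, ← Ideal.radical_eq_iff, ← IsLocalization.map_radical (M := (hW.primeIdealOf ⟨x, hx⟩).asIdeal.primeCompl)
    (S := X.presheaf.stalk x), Ideal.radical_eq_iff.mpr hJ]

namespace CartierDivisor

open RatFn ComplementDivisor

variable {X : Scheme.{u}} [IsIntegral X] {D : CartierDivisor X}

/-! ## §2 The points of `Z(D)` -/

/-- **The points of `Z(D)` are the points of `Supp D`**: `x` lies on the closed subscheme of the effective Cartier divisor `D` iff `D`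
does not avoid `x` (its local equation is not a unit at `x`). [cite: GortzWedhorn2020, Remark 11.27 and (11.12) (pp. 305–306)] -/
theorem IsEffective.mem_range_subschemeι_iff (hD : D.IsEffective) {x : X} :
    x ∈ Set.range hD.idealSheaf.subschemeι ↔ ¬ D.Avoids x := by
  rw [Scheme.IdealSheafData.range_subschemeι, ← hD.mem_support_idealSheaf_iff]
  rfl

/-! ## §3 Reduced `Z(D)`: radical local equations -/

/-- **`Z(D)` reduced ⇒ every local equation `f_i` of `D` is radical at every `x ∈ U_i`** (`(f_i)·𝒪_{X,x}` is a radical ideal): on a small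
affine `W ∋ x` the equation is a section `t` with `𝒪_X(−D)(W) = (t)` (★ `sectionIdeal_eq_span`), radical by §1, hence radical in
`𝒪_{X,x}` (§1) and `f_i` is `ComplementDivisor.RadicalAt x` (★ `radicalAt_of_isRadical`). [cite: GortzWedhorn2020, Remark 11.27 and (11.12) (pp. 305–306)] -/
theorem IsEffective.radicalAt_of_isReduced (hD : D.IsEffective) [IsReduced hD.idealSheaf.subscheme] {x : X} {i : D.ι}
    (hi : x ∈ D.U i) : RadicalAt x (D.f i) := by
  obtain ⟨W, hxW, hWi, -, t, ht⟩ := hD.exists_affine_secFn_eq hi (O := ⊤) trivial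
  -- `(t) ⊆ Γ(W)` is radical, hence so is `(germ_x t) ⊆ 𝒪_{X,x}`
  have hrad : (Ideal.span {t}).IsRadical := by
    rw [← sectionIdeal_eq_span hxW hWi ht, ← hD.ideal_idealSheaf W]
    exact isRadical_ideal_of_isReduced_subscheme hD.idealSheaf W
  have hrad' := isRadical_map_germ W.2 hxW hrad
  rw [Ideal.map_span, Set.image_singleton] at hrad'
  -- `f_i` is the rational function of `germ_x t ≠ 0`
  have e : D.f i = toFunctionField x (X.presheaf.germ W x hxW t) := by
    rw [toFunctionField_germ_eq_secFn hxW hxW, ht]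
  have hne : (X.presheaf.germ W x hxW).hom t ≠ 0 := fun h0 =>
    D.f_ne_zero i (by rw [e]; exact (congrArg (toFunctionField x) h0).trans (map_zero _))
  rw [e]
  exact radicalAt_of_isRadical hne hrad'

/-! ## §4 Radical local equations have order `≤ 1` at discrete-valuation-ring points -/

section DVR

variable [IsLocallyNoetherian X] {x : X} [IsDiscreteValuationRing (X.presheaf.stalk x)]

/-- A uniformizer at a point with discrete valuation ring: a rational function of order `1` at `x`. [folklore] -/
private theorem exists_ord_eq_one' : ∃ π : X.functionField, π ≠ 0 ∧ Scheme.ord π x = 1 := by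
  obtain ⟨ϖ, hϖ⟩ := IsDiscreteValuationRing.exists_irreducible (X.presheaf.stalk x)
  refine ⟨toFunctionField x ϖ, (map_ne_zero_iff _ (toFunctionField_injective x)).2 hϖ.ne_zero, ?_⟩
  rw [CurvePlaces.ord_toFunctionField_eq_addVal hϖ.ne_zero, IsDiscreteValuationRing.addVal_uniformizer hϖ]
  rfl

/-- **A radical local equation has order `≤ 1`** at a point `x` whose local ring is a discrete valuation ring: for `g = f_i` regular and
radical at `x` with `n = ord_x(g) ≥ 0` and a uniformizer `π`, `πⁿ/g ∈ 𝒪_{X,x}` gives `π/g ∈ 𝒪_{X,x}`, i.e. `1 − n ≥ 0`.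
[cite: Hartshorne1977, II.6 p. 130 (the valuation v_Y) and Prop. 6.11 (pp. 141–142)] -/
theorem IsEffective.ordAt_le_one_of_radicalAt (hD : D.IsEffective) {i : D.ι} (hi : x ∈ D.U i) (hrad : RadicalAt x (D.f i)) :
    D.ordAt x ≤ 1 := by
  rw [D.ordAt_eq_ord hi]
  have hreg : IsRegularAt x (D.f i) := hD i x hi
  have hg0 : D.f i ≠ 0 := D.f_ne_zero i
  have hnn : 0 ≤ Scheme.ord (D.f i) x := hreg.ord_nonneg
  obtain ⟨π, hπ0, hπ⟩ := exists_ord_eq_one' (x := x)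
  obtain ⟨m, hm⟩ : ∃ m : ℕ, Scheme.ord (D.f i) x = m := ⟨(Scheme.ord (D.f i) x).toNat, (Int.toNat_of_nonneg hnn).symm⟩
  have hπreg : IsRegularAt x π := (CurvePlaces.isRegularAt_iff_ord_nonneg hπ0).2 (by omega)
  -- `π^m / g` is regular (its order is `m − m = 0`)
  have h1 : IsRegularAt x (π ^ m / D.f i) := by
    rw [CurvePlaces.isRegularAt_iff_ord_nonneg (div_ne_zero (pow_ne_zero _ hπ0) hg0)]
    have e := Scheme.ord_mul (x := x) (div_ne_zero (pow_ne_zero m hπ0) hg0) hg0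
    rw [div_mul_cancel₀ _ hg0, Scheme.ord_pow' hπ0, hπ] at e
    omega
  -- radicality: `π / g` is regular, so `ord g ≤ 1`
  have h2 := hrad π m hπreg h1
  rw [CurvePlaces.isRegularAt_iff_ord_nonneg (div_ne_zero hπ0 hg0)] at h2
  have e := Scheme.ord_mul (x := x) (div_ne_zero hπ0 hg0) hg0
  rw [div_mul_cancel₀ _ hg0, hπ] at e
  omega

/-- **`Z(D)` reduced ⇒ `ord_x(D) ≤ 1`** at every point `x` whose local ring `𝒪_{X,x}` is a discrete valuation ring (effective Cartier
divisor `D` on an integral locally Noetherian scheme). [cite: Hartshorne1977, II.6 p. 130 (the valuation v_Y) and Prop. 6.11 (pp. 141–142)]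
[cite: GortzWedhorn2020, Remark 11.27 and (11.12) (pp. 305–306)] -/
theorem IsEffective.ordAt_le_one_of_isReduced (hD : D.IsEffective) [IsReduced hD.idealSheaf.subscheme] : D.ordAt x ≤ 1 := by
  obtain ⟨i, hi⟩ := D.covers x
  exact hD.ordAt_le_one_of_radicalAt hi (hD.radicalAt_of_isReduced hi)

/-- **`Z(D)` reduced ⇒ `ord_x(D) = 1` on `Supp D`** (at discrete-valuation-ring points): `≤ 1` by reducedness, `≥ 1` since the local
equation is not a unit at `x ∈ Supp D` (★ `IsEffective.ordAt_pos`). [cite: Hartshorne1977, II.6 p. 130 (the valuation v_Y) and Prop. 6.11 (pp. 141–142)] -/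
theorem IsEffective.ordAt_eq_one_of_isReduced (hD : D.IsEffective) [IsReduced hD.idealSheaf.subscheme] (hx : ¬ D.Avoids x) :
    D.ordAt x = 1 := by
  refine le_antisymm hD.ordAt_le_one_of_isReduced ?_
  obtain ⟨i, hi⟩ := D.covers x
  have hu : ¬ IsUnitAt x (D.f i) := fun h => hx (Avoids.of_mem hi h)
  have hpos := hD.ordAt_pos hi hu CurvePlaces.coheight_eq_one_of_isDiscreteValuationRing
  omega

/-- Conversely to nothing: off the support the order is `0` (★ `Avoids.ordAt_eq_zero`), so for reduced `Z(D)` the order at a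
discrete-valuation-ring point is `1` or `0` according as `x ∈ Supp D` or not. [cite: Hartshorne1977, II.6 p. 130 (the valuation v_Y) and Prop. 6.11 (pp. 141–142)] -/
theorem IsEffective.ordAt_eq_ite_of_isReduced (hD : D.IsEffective) [IsReduced hD.idealSheaf.subscheme] [Decidable (D.Avoids x)] :
    D.ordAt x = if D.Avoids x then 0 else 1 := by
  split_ifs with h
  · exact h.ordAt_eq_zero
  · exact hD.ordAt_eq_one_of_isReduced h

end DVR

end CartierDivisor

/-! ## §5 Smooth curves over a field -/

namespace CurvePlaces

open RatFn

variable {K : Type u} [Field K] {C : SchemeOver K} [IsIntegral C.left] [SmoothOfRelativeDimension 1 C.hom]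

/-- **On a smooth curve, a reduced effective Cartier divisor has `ord_x(E) ≤ 1` at every closed point** (the local rings at the
non-generic points are discrete valuation rings, ★ `isDiscreteValuationRing_stalk`).  This is the «multiplicity one» reading of a reduced
fibre in Step I of [Milne, Jacobian varieties, Lem. 6.7] / [Lange, Lem. 4.4.4]. [cite: Hartshorne1977, II.6 p. 130 (the valuation v_Y) and Prop. 6.11 (pp. 141–142)]
[cite: GortzWedhorn2020, Remark 11.27 and (11.12) (pp. 305–306)] -/
theorem ordAt_le_one_of_isReduced_subscheme {E : CartierDivisor C.left} (hE : E.IsEffective)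
    [IsReduced hE.idealSheaf.subscheme] {x : C.left} (hx : x ≠ genericPoint C.left) : E.ordAt x ≤ 1 := by
  haveI : Smooth C.hom := SmoothOfRelativeDimension.smooth 1 C.hom
  haveI := isDiscreteValuationRing_stalk C hx
  exact hE.ordAt_le_one_of_isReduced

/-- **On a smooth curve, a reduced effective Cartier divisor has `ord_x(E) = 1` at every closed point of its support.**
[cite: Hartshorne1977, II.6 p. 130 (the valuation v_Y) and Prop. 6.11 (pp. 141–142)] -/
theorem ordAt_eq_one_of_isReduced_subscheme {E : CartierDivisor C.left} (hE : E.IsEffective)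
    [IsReduced hE.idealSheaf.subscheme] {x : C.left} (hx : x ≠ genericPoint C.left) (hEx : ¬ E.Avoids x) : E.ordAt x = 1 := by
  haveI : Smooth C.hom := SmoothOfRelativeDimension.smooth 1 C.hom
  haveI := isDiscreteValuationRing_stalk C hx
  exact hE.ordAt_eq_one_of_isReduced hEx

end CurvePlaces

end Literature.AlgebraicGeometry.Motives

end
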